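import Mathlib
import Summits.FinalStateConjecture.FinalStateConjecture.Theorems.LaminatedThresholdCombLemmaAbstract
import Summits.FinalStateConjecture.FinalStateConjecture.Theorems.LaminatedThresholdCombSeeds
import Summits.FinalStateConjecture.FinalStateConjecture.Theorems.LaminatedThresholdCombGlobalise

/-!
# The corrected comb lemma (crux `LaminatedThreshold`, line `heteroclinic_comb`, Stub 1 re-typed)

`stub_combLemma` of `Cruxes/LaminatedThreshold/Lines/heteroclinic_comb.lean` is FALSE as typed
(`Theorems/LaminatedThreshold/Negative/HeteroclinicCombLemmaFalse.lean`: the seeds are anchored on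
the `t`-axis, which need not be the unstable manifold). This file proves the lemma with its exact
binder structure under the ONE additional hypothesis that the coordinates are ADAPTED — the
`t`-axis is `T`-invariant, `∀ t, |t| < r₀ → (T (0, t)).1 = 0` (for a `C¹` map with a
one-dimensional unstable direction this is a choice of coordinates straightening the local
unstable manifold). The proof is the cone-field λ-lemma `comb_abstract` applied to the
globalisation `exists_globalisation` of `T`, with the seed graphs of `exists_seed_graph`.

Consumer: `comb_lemma_adapted` is verbatim the first hypothesis of
`LaminatedThreshold.laminatedThreshold_of_adaptedComb` (`LaminatedThresholdAdaptedCombReduction.lean`,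
seat 0), the by-name composition of the re-typed line; discharging it leaves the crux reduced to the
two general-relativistic stubs (adapted vacuum comb carrier, naked ⇒ not settled).
-/

set_option linter.dupNamespace false

namespace Summit.FinalStateConjecture.FinalStateConjecture.Theorems.LaminatedThreshold.Comb

open Set Function Filter Topology Metric

/-- Orbits of two maps that agree on a closed ball coincide as long as they stay in it.
[folklore] -/
theorem iterate_eq_of_agree {X : Type*} [SeminormedAddCommGroup X] {T T' : X → X} {r : ℝ}
    (hagree : ∀ p : X, ‖p‖ ≤ r → T' p = T p) (p : X) (n : ℕ)
    (hstay : ∀ j < n, ‖T'^[j] p‖ ≤ r) : T^[n] p = T'^[n] p := by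
  induction n with
  | zero => rfl
  | succ n ih =>
    rw [iterate_succ_apply', iterate_succ_apply', ih fun j hj ↦ hstay j (Nat.lt_succ_of_lt hj),
      hagree _ (hstay n (Nat.lt_succ_self n))]

/-- **The comb lemma in adapted coordinates** (Stub 1 of line `heteroclinic_comb`, corrected:
the registered signature plus the axis-invariance hypothesis). [folklore] -/
theorem comb_lemma_adapted : ∀ (E : Type) [NormedAddCommGroup E] [NormedSpace ℝ E] [CompleteSpace E] (T : E × ℝ → E × ℝ) (S : E →L[ℝ] E) (μ r₀ : ℝ), T 0 = 0 → 0 < r₀ → ContDiffOn ℝ 1 T (Metric.ball 0 r₀) → HasFDerivAt T ((S.comp (ContinuousLinearMap.fst ℝ E ℝ)).prod (μ • ContinuousLinearMap.snd ℝ E ℝ)) 0 → ‖S‖ < 1 → 1 < μ → (∀ t : ℝ, |t| < r₀ → (T ((0 : E), t)).1 = 0) → ∃ r₁ : ℝ, 0 < r₁ ∧ ∀ (σ₁ σ₂ : ℝ) (G₁ G₂ : E × ℝ → ℝ), 0 < σ₁ ∧ σ₁ < r₁ ∧ -r₁ < σ₂ ∧ σ₂ < 0 ∧ (∃ r' : ℝ,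 0 < r' ∧ ContDiffOn ℝ 1 G₁ (Metric.ball ((0 : E), σ₁) r') ∧ ContDiffOn ℝ 1 G₂ (Metric.ball ((0 : E), σ₂) r')) ∧ G₁ ((0 : E), σ₁) = 0 ∧ fderiv ℝ G₁ ((0 : E), σ₁) ((0 : E), (1 : ℝ)) ≠ 0 ∧ G₂ ((0 : E), σ₂) = 0 ∧ fderiv ℝ G₂ ((0 : E), σ₂) ((0 : E), (1 : ℝ)) ≠ 0 → ∀ ε : ℝ, 0 < ε → ∃ ρ : ℝ, 0 < ρ ∧ ∃ (Φ : E × ℝ → ℝ) (K : Set ℝ), Φ 0 = 0 ∧ (0 : ℝ) ∈ K ∧ (∀ η : ℝ, 0 < η → (K ∩ Set.Ioo (0 - η) 0).Nonempty ∧ (K ∩ Set.Ioo 0 (0 + η)).Nonempty) ∧ ContinuousOn Φ (Metric.ball 0 ρ) ∧ ∀ p ∈ Metric.ball (0 : E × ℝ) ρ, Φ p ∈ K → ((∀ n : ℕ, T^[n] p ∈ Metric.ball (0 : E × ℝ) ε) ∨ (∃ n : ℕ, T^[n] p ∈ Metric.ball ((0 : E), σ₁) ε ∧ G₁ (T^[n]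 p) = 0) ∨ (∃ n : ℕ, T^[n] p ∈ Metric.ball ((0 : E), σ₂) ε ∧ G₂ (T^[n] p) = 0)) := by
  intro E _ _ _ T S μ r₀ hT0 hr₀ hTC1 hDT0 hS hμ haxis
  -- the size `η` of the nonlinearity and the globalised map
  obtain ⟨η, hη0, hη1, hη2⟩ : ∃ η : ℝ, 0 < η ∧ η ≤ (1 - ‖S‖) / 2 ∧ η ≤ (μ - 1) / 4 :=
    ⟨min ((1 - ‖S‖) / 2) ((μ - 1) / 4), lt_min (by linarith) (by linarith), min_le_left _ _,
      min_le_right _ _⟩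
  obtain ⟨r, hr, hrr₀, T', hT'c, hagree, hH1, hH3, hconeκ⟩ :=
    exists_globalisation hT0 hr₀ hTC1 hDT0 hμ haxis hη0 hη1
  refine ⟨r / 2, by positivity, ?_⟩
  rintro σ₁ σ₂ G₁ G₂ ⟨hσ₁, hσ₁r, hσ₂r, hσ₂, ⟨r', hr', hG₁, hG₂⟩, hG₁0, hG₁t, hG₂0, hG₂t⟩ ε hε
  -- the seed graphs (Lipschitz constants first)
  obtain ⟨kg₁, hkg₁, hseed₁⟩ := exists_seed_graph hr' hG₁ hG₁0 hG₁t
  obtain ⟨kg₂, hkg₂, hseed₂⟩ := exists_seed_graph hr' hG₂ hG₂0 hG₂t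
  obtain ⟨kg, hkg0, hkg1, hkg2⟩ : ∃ kg : ℝ, 0 ≤ kg ∧ kg₁ ≤ kg ∧ kg₂ ≤ kg :=
    ⟨max kg₁ kg₂, hkg₁.trans (le_max_left _ _), le_max_left _ _, le_max_right _ _⟩
  -- the cone aperture and the thin tube
  obtain ⟨κ, hκ0, hκ1, hkgκ⟩ : ∃ κ : ℝ, 0 < κ ∧ κ ≤ 1 ∧ kg * κ < 1 := by
    refine ⟨1 / (2 * (kg + 1)), by positivity, ?_, ?_⟩
    · rw [div_le_one (by positivity)]; linarith
    · rw [← mul_div_assoc, mul_one, div_lt_one (by positivity)]; linarith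
  obtain ⟨ρ', hρ', hρ'r, hcone⟩ := hconeκ κ hκ0 hκ1
  -- the expansion `θ` and the accuracy `ε₁` of the seed graphs
  obtain ⟨θ, hθ, hθ1⟩ : ∃ θ : ℝ, θ = μ - η - η ∧ 1 < θ := ⟨μ - η - η, rfl, by linarith⟩
  obtain ⟨ε₁, hε₁0, hε₁ε, hε₁r, habp, habm, hε₁σ₁', hε₁σ₂'⟩ : ∃ ε₁ : ℝ, 0 < ε₁ ∧ ε₁ ≤ ε / 2 ∧
      ε₁ ≤ r / 4 ∧ σ₁ + ε₁ < θ * (σ₁ - ε₁) ∧ θ * (σ₂ + ε₁) < σ₂ - ε₁ ∧ ε₁ < σ₁ / 2 ∧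
      ε₁ < -σ₂ / 2 := by
    set c : ℝ := (θ - 1) / (2 * (θ + 1)) with hc
    have hc0 : 0 < c := by positivity
    have hcθ : c * (2 * (θ + 1)) = θ - 1 := by simp only [hc]; field_simp
    have hc_half : c < 1 / 2 := by
      rw [hc, div_lt_div_iff₀ (by positivity) (by norm_num)]; linarith
    refine ⟨min (ε / 2) (min (r / 4) (min (σ₁ * c) (-σ₂ * c))), ?_, min_le_left _ _,
      (min_le_right _ _).trans (min_le_left _ _), ?_, ?_, ?_, ?_⟩
    · exact lt_min (by positivity) (lt_min (by positivity) (lt_min (by positivity)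
        (mul_pos (by linarith) hc0)))
    · have hle : min (ε / 2) (min (r / 4) (min (σ₁ * c) (-σ₂ * c))) ≤ σ₁ * c :=
        ((min_le_right _ _).trans (min_le_right _ _)).trans (min_le_left _ _)
      have h1 : min (ε / 2) (min (r / 4) (min (σ₁ * c) (-σ₂ * c))) * (2 * (θ + 1)) ≤
          σ₁ * (θ - 1) := by
        calc _ ≤ σ₁ * c * (2 * (θ + 1)) := by gcongr
          _ = σ₁ * (θ - 1) := by rw [mul_assoc, hcθ]
      nlinarith
    · have hle : min (ε / 2) (min (r / 4) (min (σ₁ * c) (-σ₂ * c))) ≤ -σ₂ * c :=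
        ((min_le_right _ _).trans (min_le_right _ _)).trans (min_le_right _ _)
      have h1 : min (ε / 2) (min (r / 4) (min (σ₁ * c) (-σ₂ * c))) * (2 * (θ + 1)) ≤
          -σ₂ * (θ - 1) := by
        calc _ ≤ -σ₂ * c * (2 * (θ + 1)) := by gcongr
          _ = -σ₂ * (θ - 1) := by rw [mul_assoc, hcθ]
      nlinarith
    · have hle : min (ε / 2) (min (r / 4) (min (σ₁ * c) (-σ₂ * c))) ≤ σ₁ * c :=
        ((min_le_right _ _).trans (min_le_right _ _)).trans (min_le_left _ _)
      nlinarith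
    · have hle : min (ε / 2) (min (r / 4) (min (σ₁ * c) (-σ₂ * c))) ≤ -σ₂ * c :=
        ((min_le_right _ _).trans (min_le_right _ _)).trans (min_le_right _ _)
      nlinarith
  obtain ⟨α₁, hα₁, g₁, hg₁, hg₁lip⟩ := hseed₁ ε₁ hε₁0
  obtain ⟨α₂, hα₂, g₂, hg₂, hg₂lip⟩ := hseed₂ ε₁ hε₁0
  -- the final radius
  obtain ⟨ρ, hρ0, hρρ', hρα₁, hρα₂, hρε, hρσ₁, hρσ₂⟩ : ∃ ρ : ℝ, 0 < ρ ∧ ρ ≤ ρ' ∧ ρ ≤ α₁ ∧ ρ ≤ α₂ ∧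
      ρ ≤ ε / 2 ∧ ρ ≤ σ₁ / 4 ∧ ρ ≤ -σ₂ / 4 := by
    refine ⟨min (min ρ' (min α₁ α₂)) (min (ε / 2) (min (σ₁ / 4) (-σ₂ / 4))), ?_, ?_, ?_, ?_, ?_, ?_, ?_⟩
    · refine lt_min (lt_min hρ' (lt_min hα₁ hα₂)) (lt_min (by positivity) (lt_min (by positivity) ?_))
      linarith
    · exact (min_le_left _ _).trans (min_le_left _ _)
    · exact ((min_le_left _ _).trans (min_le_right _ _)).trans (min_le_left _ _)
    · exact ((min_le_left _ _).trans (min_le_right _ _)).trans (min_le_right _ _)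
    · exact (min_le_right _ _).trans (min_le_left _ _)
    · exact ((min_le_right _ _).trans (min_le_right _ _)).trans (min_le_left _ _)
    · exact ((min_le_right _ _).trans (min_le_right _ _)).trans (min_le_right _ _)
  have hρr : ρ ≤ r := hρρ'.trans hρ'r
  -- the abstract comb lemma for the globalised map
  rw [hθ] at habp habm hθ1
  obtain ⟨Φ, K, hΦ0, h0K, hacc, hΦc, htri⟩ := comb_abstract (T := T') (gp := g₁) (gm := g₂)
    (ρ := ρ) (lam := ‖S‖ + η) (μ := μ - η) (κ := κ) (δ := η) (ap := σ₁ - ε₁) (bp := σ₁ + ε₁)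
    (am := σ₂ + ε₁) (bm := σ₂ - ε₁) (kg := kg) hT'c hρ0 (by positivity) (by linarith) hκ0.le
    hη0.le hθ1
    (fun p hp ↦ hH1 p (hp.trans hρr))
    (fun p q hp hq hpq hcpq ↦ hcone p q (hp.trans hρρ') (hq.trans hρρ') hpq hcpq)
    (fun x hx ↦ hH3 x (hx.trans hρr))
    (fun x hx ↦ by linarith [(abs_lt.1 (hg₁ x (hx.trans hρα₁)).2).1])
    (fun x hx ↦ by linarith [(abs_lt.1 (hg₁ x (hx.trans hρα₁)).2).2])
    (by linarith) habp
    (fun x x' hx hx' ↦ (hg₁lip x x' (hx.trans hρα₁) (hx'.trans hρα₁)).trans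
      (mul_le_mul_of_nonneg_right hkg1 (norm_nonneg _)))
    (fun x hx ↦ by linarith [(abs_lt.1 (hg₂ x (hx.trans hρα₂)).2).2])
    (fun x hx ↦ by linarith [(abs_lt.1 (hg₂ x (hx.trans hρα₂)).2).1])
    (by linarith) habm
    (fun x x' hx hx' ↦ (hg₂lip x x' (hx.trans hρα₂) (hx'.trans hρα₂)).trans
      (mul_le_mul_of_nonneg_right hkg2 (norm_nonneg _)))
    hkg0 hkgκ
  refine ⟨ρ, hρ0, Φ, K, hΦ0, h0K, hacc, hΦc, fun p hp hpK ↦ ?_⟩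
  have hp1 : ‖p.1‖ < ρ := lt_of_le_of_lt (norm_fst_le p) (mem_ball_zero_iff.1 hp)
  rcases htri p hp hpK with hstay | ⟨n, hhit, hbox⟩ | ⟨n, hhit, hbox⟩
  · -- the orbit stays in the ball `ρ ⊆ ball ε`, and is a `T`-orbit
    left
    intro n
    have heq : T^[n] p = T'^[n] p := iterate_eq_of_agree hagree p n fun j _ ↦
      ((mem_ball_zero_iff.1 (hstay j)).trans_le hρr).le
    rw [heq, mem_ball_zero_iff]
    exact (mem_ball_zero_iff.1 (hstay n)).trans_le (by linarith)
  · -- the orbit lands on the upper seed graph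
    right; left
    have hstayr : ∀ j < n, ‖T'^[j] p‖ ≤ r := by
      intro j hj
      obtain ⟨h1, h2, h3⟩ := hbox j hj.le
      rw [Prod.norm_def, Real.norm_eq_abs]
      refine max_le (h1.trans (hp1.le.trans hρr)) (abs_le.2 ⟨?_, ?_⟩) <;> linarith
    have heq : T^[n] p = T'^[n] p := iterate_eq_of_agree hagree p n hstayr
    obtain ⟨h1, -, -⟩ := hbox n le_rfl
    have hq1 : ‖(T'^[n] p).1‖ ≤ α₁ := h1.trans (hp1.le.trans hρα₁)
    have hform : T'^[n] p = ((T'^[n] p).1, g₁ (T'^[n] p).1) := Prod.ext rfl hhit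
    refine ⟨n, ?_, ?_⟩
    · rw [heq, mem_ball, Prod.dist_eq, hform]
      simp only [dist_zero_right, Real.dist_eq]
      refine max_lt (h1.trans_lt (hp1.trans_le (by linarith))) ?_
      exact (hg₁ _ hq1).2.trans_le (by linarith)
    · rw [heq, hform]; exact (hg₁ _ hq1).1
  · -- the orbit lands on the lower seed graph
    right; right
    have hstayr : ∀ j < n, ‖T'^[j] p‖ ≤ r := by
      intro j hj
      obtain ⟨h1, h2, h3⟩ := hbox j hj.le
      rw [Prod.norm_def, Real.norm_eq_abs]
      refine max_le (h1.trans (hp1.le.trans hρr)) (abs_le.2 ⟨?_, ?_⟩) <;> linarith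
    have heq : T^[n] p = T'^[n] p := iterate_eq_of_agree hagree p n hstayr
    obtain ⟨h1, -, -⟩ := hbox n le_rfl
    have hq1 : ‖(T'^[n] p).1‖ ≤ α₂ := h1.trans (hp1.le.trans hρα₂)
    have hform : T'^[n] p = ((T'^[n] p).1, g₂ (T'^[n] p).1) := Prod.ext rfl hhit
    refine ⟨n, ?_, ?_⟩
    · rw [heq, mem_ball, Prod.dist_eq, hform]
      simp only [dist_zero_right, Real.dist_eq]
      refine max_lt (h1.trans_lt (hp1.trans_le (by linarith))) ?_
      exact (hg₂ _ hq1).2.trans_le (by linarith)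
    · rw [heq, hform]; exact (hg₂ _ hq1).1

end Summit.FinalStateConjecture.FinalStateConjecture.Theorems.LaminatedThreshold.Comb
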